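/-
Copyright: the b2b-balaban cell (near-miss cell 7), T⁴-continuum fan-out; row NE7b ROUND-2 swarm, seat
t4-ne7b-formalise-leaf-02 (gen 2; row S12d «R7 per-run S-profile END twin» of `t4/b2b-balaban-t4-ne7b-p1/LEAVES-NE7b.md`,
typer's diagnostic T-NE7b-7 of `t4/formal/NE7b/DAG.md`; journal CLAIM l.8092).  Released under the licence of the
surrounding project.
-/
import Summits.QuantumFields.BalabanUV.T4Continuum.Support.HistoryAssemblyRealisePrice
import Summits.QuantumFields.BalabanUV.T4Continuum.Support.HistoryLevelsFlow

/-!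
# History assembly, THE INSTANCE WITH A PER-RUN S-PROFILE (typer T-NE7b-7): realised pending pedigrees, cutoff by cutoff

Summits-side support leaf of the T⁴-continuum cell (rung (B)+1 on a FINITE torus only; NOT infinite volume, NOT the
mass gap, NOT the Clay statement; NOT a proof of the spine estimate NE7b).  Row NE7b, route «COUNT», ROUND-2 swarm
row S12d (the typer's located remedy R7 for the END of row S12).  [folklore] RE-TYPING + COMPOSITION BY NAME of landed
theorems of the cell; nothing is quoted from print, nothing printed is asserted, no `[cite:]` tag; ONE hypothesis SHAPE
(`RealisedReadingR`, leaf-03's `HistoryAssemblyRealiseLE.RealisedReading` with the S-profile indexed by the cutoff) and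
ONE ℕ-valued bookkeeping definition (`runProfile`); no `Prop`-valued fact of Bałaban's is minted (trigger c1).

WHY (T-NE7b-7, typer, journal l.7835).  Leaf-03's instance ENDs `hybridNE7_of_realisedReading_canon` (p210803) ∕
`_printed` (p210969) quantify ONE exponent profile `sP : ℕ → ℕ` for ALL cutoffs `K`: the displayed reading
`RealisedReading F.L sP …` asks `Realises F.L sP (R K) …` — orbit blocking exponents from the K-INDEPENDENT `sP`, sizes
`R K ·` PER RUN.  In print the run at cutoff `K` (`D.C ⟨K, F.m, g₀ K⟩`, tuned to end at `g`) has its own sizes `R K s`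
and hence its own exponents `s = log_L R K s` ((2.5)); the ENDs as typed are print-instantiable only if all tuned runs
share one profile, which `Tuned` does not give.  REMEDY here, append-only: (R7-a) the reading with a profile PER CUTOFF
`s : ℕ → ℕ → ℕ` (`real : Realises F.L (s K) (R K) …`) — every geometric bridge lemma of row S1b (leaf-08:
`consistentTLE_genT_of_realises`, `lt_reach_genT_of_pendingAt`) is applied per `K` anyway — with the drop control
displayed per `K`; (R7-b) NO free profile at all: `runProfile F.L R K` := the exponents OF THE RUN, `expOf F.L (R K)`
(leaf-07 gen 2, `HistoryLevelsFlow`), frozen beyond the cutoff, whose drop control is a THEOREM of the END's own flow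
side (`dropCtl_expOf`: tuning ⇒ the interval, `SmallnessFor` at exponent `rr` ⇒ (2.7), `B16SProfile.theta_le_pow` ⇒
the located smallness under the one extra flow binder `β₀ ≤ ½`), so the `hdrop` display DISAPPEARS.

WHAT.  §1 `structure RealisedReadingR` (= `RealisedReading` with `s K` for `s`), `RealisedReadingR.of_realisedReading`
(a constant profile is a per-cutoff profile), **`termReadingLE_of_realisedR`** (leaf-03's `termReadingLE_of_realised`,
token-identical proof, `hdrop` per `K`).  §2 `runProfile`, `dropCtl_clampTail`, **`dropCtl_runProfile`**.  §3 the END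
**`hybridNE7_of_realisedReadingR_canon`** (R7-a: `hdrop : ∀ K ≥ K₀, ∀ m, DropCtl (s K) m` displayed); the R7-b END
`hybridNE7_of_realisedRun_canon` (reading `RealisedReadingR F.L (runProfile F.L R) …`, NO `hdrop`, `+ (hβ : β₀ ≤ 1∕2)`) and
the printed-currency twins are `Support/HistoryAssemblyRealiseRunEnd` (same seat).  Conclusions byte-identical with
leaf-03's.

WHAT STAYS DISPLAYED (census, R7-b form).  Side conditions `4 ≤ F.L`, `13 ≤ C.n₁`, `1 ≤ R K t`; the reading map
(`ped`, `cellP`, `liveC`, `cellOf`) with `RealisedReadingR F.L (runProfile F.L R) …` (encoding `renew_step`∕`forest`∕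
`headOldest`; geometric `real` AGAINST THE RUN'S OWN EXPONENTS; root cells `cell_mem`∕`cell_inj` = node A12-I.2 (iii),
leaf-08 gen 2's `HistoryRealiseCells`); per-term price readings; `Regeneration` numerator fields; constants (+ two
largeness conditions); flow side (⇐ BetaPertH) `+ β₀ ≤ ½`; tuning; `irThresholdTLE C F.L rr β₀ ≤ log g⁻²`; (2.5); (B);
seams.  Sub-class displays: none of `RenewAtReach` (LE road); `NoDropInLife` (S6f) and `BirthShapeNodup` (zone form,
S6g′) as before.

HEADLINE (c4): «COUNT route END re-typed with the S-profile OF EACH TUNED RUN (T-NE7b-7 closed on the statement side;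
drop control discharged from the flow under β₀ ≤ ½); H3 + (B) + BetaPertH-flow + NE7c socket + NE7 core budget
displayed» — NOT «NE7b proved».  HONEST DEPENDENCY (cell): continuum YM on T⁴ ⇐ BetaPertH ∧ nine spine estimates (0/9
proved); BetaPertH ⇐ (D1) ∧ (D4) ∧ CAP+tail.  This file changes none of it.
-/

open Finset MeasureTheory
open Literature.MathematicalPhysics.QuantumFieldTheory.Balaban1983to89
open T4PersistenceDictionary T4PersistentHistoryCount T4BankedInduction T4PrintedShapeBanking
open T4WeightBudget T4GlobalDenominator T4LiveClassFibration T4LiveStructureGas T4LiveGasToTerms T4RecordPriceSeam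
open T4PartnerMultiplicity T4IndicatorShell T4MatchingAssembly T4MatchingClosure T4MatchingClosureSocket T4Continuum
open T4StabilitySocket T4BranchingRecordsGas T4TaggedShapeBanking T4CanonicalMenus T4RenewalChains
open Summit.QuantumFields.BalabanUV.T4Continuum.PlacementBatch
open Summit.QuantumFields.BalabanUV.T4Continuum.PlacementSkeleton
open Summit.QuantumFields.BalabanUV.T4Continuum.CountThresholdUniform
open Summit.QuantumFields.BalabanUV.T4Continuum.CountThresholdExit
open Summit.QuantumFields.BalabanUV.T4Continuum.CountSeamJunction
open Summit.QuantumFields.BalabanUV.T4Continuum.LateMergers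
open Summit.QuantumFields.BalabanUV.T4Continuum.HistoryFlow
open Summit.QuantumFields.BalabanUV.T4Continuum.HistoryRegeneration
open Summit.QuantumFields.BalabanUV.T4Continuum.HistoryTables
open Summit.QuantumFields.BalabanUV.T4Continuum.HistoryAssemblyTrees
open Summit.QuantumFields.BalabanUV.T4Continuum.HistoryAssemblyTerms
open Summit.QuantumFields.BalabanUV.T4Continuum.HistoryAssemblyPedigree
open Summit.QuantumFields.BalabanUV.T4Continuum.HistoryConstants
open Summit.QuantumFields.BalabanUV.T4Continuum.HistoryGen
open Literature.MathematicalPhysics.QuantumFieldTheory.Balaban1983to89.B13ScaleTransfer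
open Summit.QuantumFields.BalabanUV.T4Continuum.ZoneSkeleton
open Summit.QuantumFields.BalabanUV.T4Continuum.HistorySocketTH
open Summit.QuantumFields.BalabanUV.T4Continuum.HistoryCaps
open Summit.QuantumFields.BalabanUV.T4Continuum.HistoryAssemblyPrice
open Summit.QuantumFields.BalabanUV.T4Continuum.HistoryBankingLE
open Summit.QuantumFields.BalabanUV.T4Continuum.HistoryTreeShapeLE
open Summit.QuantumFields.BalabanUV.T4Continuum.HistoryExitLE
open Summit.QuantumFields.BalabanUV.T4Continuum.HistoryAssemblyTermsLE
open Summit.QuantumFields.BalabanUV.T4Continuum.HistoryRealise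
open Summit.QuantumFields.BalabanUV.T4Continuum.HistoryAssemblyRealiseLE
open Summit.QuantumFields.BalabanUV.T4Continuum.HistoryAssemblyRealisePrice
open Summit.QuantumFields.BalabanUV.T4Continuum.HistoryZones

namespace Summit.QuantumFields.BalabanUV.T4Continuum.HistoryAssemblyRealiseRun

noncomputable section

/-! ## §1 Terms read as realised pending pedigrees, S-profile PER CUTOFF -/

section Reading

variable {ι α π γ : Type*} [DecidableEq α] [DecidableEq π] [DecidableEq γ] {d : ℕ}

/-- **THE PER-TERM READING AS REALISED PENDING PEDIGREES, PROFILE PER CUTOFF** (hypothesis SHAPE; leaf-03's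
`RealisedReading` VERBATIM except that the exponent profile is indexed by the cutoff: the run at cutoff `K` realises its
pedigrees with blocking exponents `s K` and sizes `R K`).  For every `K ≥ K₀` and `τ ∈ T K`: `renew_step`, `forest`,
`headOldest` (encoding of the reading map); `real` — every live component's region history is REALISED by the blocked
persistence dynamics with profile `s K`, sizes `R K`, and PENDING at `K`; the root-cell facts `cell_mem`∕`cell_inj`
(displayed; node A12-I.2 (iii)). [folklore] -/
structure RealisedReadingR (L : ℕ) (s : ℕ → ℕ → ℕ) (Cell : ℕ → ℕ → Finset γ) (K₀ : ℕ) (R : ℕ → ℕ → ℕ)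
    (T : ℕ → Finset ι) (ped : ℕ → ι → Pedigree α π) (cellP : ℕ → ι → π → Pt d × Finset (Pt d))
    (liveC : ℕ → ι → Finset α) (cellOf : ℕ → ι → α → γ) : Prop where
  /-- encoding: a renewal is dated one step after the renewed part -/
  renew_step : ∀ K, K₀ ≤ K → ∀ τ ∈ T K, ∀ c c', Part.old c' true ∈ (ped K τ).parts c →
    (ped K τ).step c' + 1 = (ped K τ).step c
  /-- the pedigree is a forest -/
  forest : ∀ K, K₀ ≤ K → ∀ τ ∈ T K, ∀ c, (ped K τ).Forest c
  /-- oldest line first at every component -/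
  headOldest : ∀ K, K₀ ≤ K → ∀ τ ∈ T K, ∀ c, (ped K τ).HeadOldest c
  /-- every live component is realised by the blocked dynamics OF THE RUN AT CUTOFF `K` and pending at `K` -/
  real : ∀ K, K₀ ≤ K → ∀ τ ∈ T K, ∀ c ∈ liveC K τ, ∃ Z : Finset (Pt d),
    Realises L (s K) (R K) ((ped K τ).toPGen (cellP K τ) c) Z ∧
      PendingAt L (s K) (R K) ((ped K τ).toPGen (cellP K τ) c).lastStep Z K
  /-- the root cell of a live component is a cell of the root's age -/
  cell_mem : ∀ K, K₀ ≤ K → ∀ τ ∈ T K, ∀ c ∈ liveC K τ, cellOf K τ c ∈ Cell K (K - ((ped K τ).genT c).rootStep)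
  /-- distinct live components of one term have distinct root cells -/
  cell_inj : ∀ K, K₀ ≤ K → ∀ τ ∈ T K, Set.InjOn (cellOf K τ) (liveC K τ : Set α)

variable {L : ℕ} {Cell : ℕ → ℕ → Finset γ} {K₀ : ℕ} {R : ℕ → ℕ → ℕ} {T : ℕ → Finset ι}
  {ped : ℕ → ι → Pedigree α π} {cellP : ℕ → ι → π → Pt d × Finset (Pt d)} {liveC : ℕ → ι → Finset α}
  {cellOf : ℕ → ι → α → γ}

omit [DecidableEq π] [DecidableEq γ] in
/-- **A CONSTANT PROFILE IS A PER-CUTOFF PROFILE**: leaf-03's `RealisedReading L s …` gives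
`RealisedReadingR L (fun _ => s) …` (backward compatibility). [folklore] -/
theorem RealisedReadingR.of_realisedReading {s : ℕ → ℕ}
    (H : RealisedReading L s Cell K₀ R T ped cellP liveC cellOf) :
    RealisedReadingR L (fun _ => s) Cell K₀ R T ped cellP liveC cellOf where
  renew_step := H.renew_step
  forest := H.forest
  headOldest := H.headOldest
  real := H.real
  cell_mem := H.cell_mem
  cell_inj := H.cell_inj

variable {s : ℕ → ℕ → ℕ} {C : T4PrintedShapeBanking.Consts}

/-- **THE PER-CUTOFF REALISED READING GIVES THE LE TERM READING** for the member map `memOf`, caps read off the data, any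
matching scale, under the side conditions `4 ≤ L`, drop control OF EACH PROFILE `s K` (`K ≥ K₀`), `1 ≤ R K t`,
`13 ≤ C.n₁` (= leaf-03's `termReadingLE_of_realised`, each of leaf-08's lemmas applied at its own cutoff). [folklore] -/
theorem termReadingLE_of_realisedR (hL : 4 ≤ L) (hdrop : ∀ K, K₀ ≤ K → ∀ m, B16SProfile.DropCtl (s K) m)
    (hn₁ : 13 ≤ C.n₁) (hR1 : ∀ K, K₀ ≤ K → ∀ t, 1 ≤ R K t)
    (H : RealisedReadingR L s Cell K₀ R T ped cellP liveC cellOf) (jstar : ℕ → ℕ) :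
    TermReadingLE Prod.fst C Cell (dcapOf Prod.fst T (memOf ped liveC cellOf)) (ncapOf T (memOf ped liveC cellOf))
      jstar K₀ R T (memOf ped liveC cellOf) where
  consistent K hK τ hτ q hq := by
    obtain ⟨c, hc, rfl⟩ := mem_memOf.1 hq
    obtain ⟨Z, hre, hpend⟩ := H.real K hK τ (mem_badTerms.1 hτ).1 c hc
    exact consistentTLE_genT_of_realises hL (hdrop K hK) (hR1 K hK) C hn₁ (ped K τ) (cellP K τ)
      (H.renew_step K hK τ (mem_badTerms.1 hτ).1) hre hpend.1
  wf K hK τ hτ q hq := by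
    obtain ⟨c, hc, rfl⟩ := mem_memOf.1 hq
    obtain ⟨Z, hre, hpend⟩ := H.real K hK τ (mem_badTerms.1 hτ).1 c hc
    exact wf_of_consistentTLE_freshT_chrono
      (consistentTLE_genT_of_realises hL (hdrop K hK) (hR1 K hK) C hn₁ (ped K τ) (cellP K τ)
        (H.renew_step K hK τ (mem_badTerms.1 hτ).1) hre hpend.1)
      (Pedigree.freshT_genT (H.forest K hK τ (mem_badTerms.1 hτ).1) c)
      (Pedigree.chronoC_genT (H.headOldest K hK τ (mem_badTerms.1 hτ).1) c)
  pending K hK τ hτ q hq := by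
    obtain ⟨c, hc, rfl⟩ := mem_memOf.1 hq
    obtain ⟨Z, hre, hpend⟩ := H.real K hK τ (mem_badTerms.1 hτ).1 c hc
    exact lt_reach_genT_of_pendingAt hL (hdrop K hK) (hR1 K hK) C hn₁ (ped K τ) (cellP K τ)
      (H.renew_step K hK τ (mem_badTerms.1 hτ).1) hre hpend
  cell_mem K hK τ hτ q hq := by
    obtain ⟨c, hc, rfl⟩ := mem_memOf.1 hq
    exact H.cell_mem K hK τ (mem_badTerms.1 hτ).1 c hc
  chrono K hK τ hτ q hq := by
    obtain ⟨c, -, rfl⟩ := mem_memOf.1 hq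
    exact Pedigree.chronoC_genT (H.headOldest K hK τ (mem_badTerms.1 hτ).1) c
  fat_lt K hK τ hτ q hq e he hk :=
    fat_lt_of_mem Prod.fst T (memOf ped liveC cellOf) K₀ K hK τ (mem_badTerms.1 hτ).1 q hq e he hk
  fuel_le K hK τ hτ q hq := fuel_le_of_mem T (memOf ped liveC cellOf) K₀ K hK τ (mem_badTerms.1 hτ).1 q hq
  inj K hK τ hτ := by
    intro q hq q' hq' hs
    obtain ⟨c, hc, rfl⟩ := mem_memOf.1 (Finset.mem_coe.1 hq)
    obtain ⟨c', hc', rfl⟩ := mem_memOf.1 (Finset.mem_coe.1 hq')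
    have hcell : cellOf K τ c = cellOf K τ c' := by
      have := congrArg (fun s : BSlot γ PEv => s.2.1) hs
      simpa [bslotOf] using this
    have hcc : c = c' := H.cell_inj K hK τ (mem_badTerms.1 hτ).1 (Finset.mem_coe.2 hc) (Finset.mem_coe.2 hc') hcell
    subst hcc
    rfl

end Reading

/-! ## §2 The exponent profile OF THE RUN and its drop control from the flow -/

section RunProfile

/-- **THE S-PROFILE OF THE RUN AT CUTOFF `K`**: the exponents `log_L R K t` of its sizes ((2.5) makes `R K t` a power
of `L`; leaf-07 gen 2's `HistoryZones.expOf`), frozen at their value at the cutoff beyond it (where (2.5) says nothing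
and nothing is read).  Bookkeeping, ℕ-valued; an `abbrev`, DEFINITIONALLY leaf-07 gen 2's
`HistoryZones.clampExp (expOf L (R K)) K` (`HistoryLevelsFlow` v2, `clampExp s K t := s (min t K)`) — one profile, two
spellings until that append lands. [folklore] -/
abbrev runProfile (L : ℕ) (R : ℕ → ℕ → ℕ) (K t : ℕ) : ℕ := expOf L (R K) (min t K)

/-- **FREEZING THE TAIL KEEPS DROP CONTROL**: drop control up to the horizon `K` gives drop control of the profile
frozen beyond `K` up to EVERY horizon (a constant tail has no drops; the bound `max (k − i) 2` is monotone in the lag).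
(= leaf-07 gen 2's `dropCtl_clampExp` of `HistoryLevelsFlow` v2, stated on the lambda.) [folklore] -/
theorem dropCtl_clampTail {σ : ℕ → ℕ} {K : ℕ} (h : B16SProfile.DropCtl σ K) :
    ∀ m, B16SProfile.DropCtl (fun t => σ (min t K)) m := by
  intro m i k hik _
  show 2 * σ (min i K) ≤ 2 * σ (min k K) + max (k - i) 2
  by_cases hk : k ≤ K
  · rw [min_eq_left hk, min_eq_left (hik.le.trans hk)]
    exact h i k hik hk
  · have hkK : K ≤ k := (not_le.mp hk).le
    rw [min_eq_right hkK]
    by_cases hi : i < K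
    · rw [min_eq_left hi.le]
      have h1 := h i K hi le_rfl
      have h2 : max (K - i) 2 ≤ max (k - i) 2 := max_le_max (Nat.sub_le_sub_right hkK i) le_rfl
      omega
    · rw [min_eq_right (not_lt.mp hi)]
      omega

variable {F : T4Family} {G : Type*} [GaugeGroup G] [MeasurableSpace G] [HaarData G]

/-- **THE RUN'S PROFILE HAS DROP CONTROL, FROM THE FLOW** (every horizon): along the tuned run at cutoff `K` — in the
interval `]0, γb]` (tuning), with (2.7) at exponent `rr` (`SmallnessFor` antitone to `rr`, `flowIneqs_of_run`), sizes
obeying (2.5) with exponent `rr`, and the located smallness (`B16SProfile.theta_le_pow`: `β₀ ≤ ½`, `g_n²β′ ≤ γb²β′ ≤ 1`,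
`L ≥ 2`) — leaf-07 gen 2's `dropCtl_expOf` gives `DropCtl (expOf F.L (R K)) K`, and `dropCtl_clampTail` the rest.
[folklore] -/
theorem dropCtl_runProfile (D : FiniteEpsData F G) {γ₀ γb b β' β₀ : ℝ} {pe rr : ℕ} (hb : 0 ≤ b)
    (hlo : FlowStep.BetaLowerH b γ₀ D.βfun) (hhi : FlowStep.BetaUpperH β' γ₀ D.βfun) (hγ : γb ≤ γ₀)
    (hγβ : γb ^ 2 * β' < 1) (S : B14FlowStep.SmallnessFor γb β' β₀ F.L pe) (hrr : rr ≤ pe) (hβ : β₀ ≤ 1 / 2)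
    {g : ℝ} {g₀ : ℕ → ℝ} (ht : D.Tuned γb g g₀) (R : ℕ → ℕ → ℕ)
    (hR : ∀ K s, s ≤ K → B14.IsRj F.L rr ((D.C ⟨K, F.m, g₀ K⟩).flow.g s) (R K s)) (K : ℕ) :
    ∀ m, B16SProfile.DropCtl (runProfile F.L R K) m := by
  have Sr := smallnessFor_antitone hrr S
  have h27 : B14.FlowIneq27 (D.C ⟨K, F.m, g₀ K⟩).flow.g β' β₀ rr K :=
    (flowIneqs_of_run (C := D.C.toB12) (β := D.βfun) D.curries D.fwd hb hlo hhi hγ hγβ Sr ⟨K, F.m, g₀ K⟩ (ht K).1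
      (R K) fun j hj => hR K j hj).2.1
  have hI : Step.InInterval γb K (D.C ⟨K, F.m, g₀ K⟩).flow.g := fun k hk => (ht K).1 k hk
  have hΘ : ∀ m n, m < n → n ≤ K →
      (1 + ((D.C ⟨K, F.m, g₀ K⟩).flow.g n) ^ 2 * β' * ((n : ℝ) - m)) ^ β₀ ≤ (F.L : ℝ) ^ (max (n - m) 2 / 2) := by
    intro m n hmn hnK
    obtain ⟨hpos, hle⟩ := hI n hnK
    have hβ' : 0 ≤ β' := S.β'_nonneg
    have hnm : (0 : ℝ) ≤ (n : ℝ) - m := by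
      have : (m : ℝ) ≤ n := by exact_mod_cast hmn.le
      linarith
    have hX0 : 0 ≤ ((D.C ⟨K, F.m, g₀ K⟩).flow.g n) ^ 2 * β' * ((n : ℝ) - m) :=
      mul_nonneg (mul_nonneg (sq_nonneg _) hβ') hnm
    have hg1 : ((D.C ⟨K, F.m, g₀ K⟩).flow.g n) ^ 2 * β' ≤ 1 :=
      calc ((D.C ⟨K, F.m, g₀ K⟩).flow.g n) ^ 2 * β' ≤ γb ^ 2 * β' :=
            mul_le_mul_of_nonneg_right (pow_le_pow_left₀ hpos.le hle 2) hβ'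
        _ ≤ 1 := S.h27c
    have hX : ((D.C ⟨K, F.m, g₀ K⟩).flow.g n) ^ 2 * β' * ((n : ℝ) - m) ≤ ((n - m : ℕ) : ℝ) := by
      rw [Nat.cast_sub hmn.le]
      calc ((D.C ⟨K, F.m, g₀ K⟩).flow.g n) ^ 2 * β' * ((n : ℝ) - m) ≤ 1 * ((n : ℝ) - m) :=
            mul_le_mul_of_nonneg_right hg1 hnm
        _ = (n : ℝ) - m := one_mul _
    exact B16SProfile.theta_le_pow hβ hX0 hX (two_le_L F)
  exact dropCtl_clampTail (dropCtl_expOf (two_le_L F) hI S.γ_lt_one.le (fun t ht' => hR K t ht') h27 hΘ)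

end RunProfile

/-! ## §3 The END with a per-cutoff profile (drop control displayed per cutoff) -/

section End

variable {F : T4Family} {G : Type*} [GaugeGroup G] [MeasurableSpace G] [HaarData G] [RegularGaugeGroup G]
variable {α π : Type*} [DecidableEq α] [DecidableEq π] {dP : ℕ}
variable {ι : Type*} [DecidableEq ι] {l₀ vol : ℝ} {K₀ : ℕ} {T : ℕ → Finset ι} {A A' shA shB : ℕ → ℝ → ι → ℝ}
  {dead dead' : ℕ → ℝ → ι → ℝ} {nup mup : ℕ → ℝ → ℝ} {Nup : ℝ}
  {Cc Rr CcRec RrRec : ℕ → ℝ → ι → ℝ} {ν u s₂ q₀ r s Wsh : ℕ → ℝ}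

/-- **NE7b's COUNT EXIT WITH THE LIVE STRUCTURES READ AS REALISED PENDING PEDIGREES, S-PROFILE PER CUTOFF** (R7-a).
Leaf-03's `HistoryAssemblyRealiseLE.hybridNE7_of_realisedReading_canon` with the reading `RealisedReadingR F.L sP …`
(`sP : ℕ → ℕ → ℕ`, `real` against `sP K`) and the drop control displayed per cutoff
(`hdrop : ∀ K ≥ K₀, ∀ m, DropCtl (sP K) m`); everything else and the conclusion byte-identical. [folklore] -/
theorem hybridNE7_of_realisedReadingR_canon (D : FiniteEpsData F G) {C : T4PrintedShapeBanking.Consts}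
    {rr : ℕ} {β₀ : ℝ} (h : ThresholdOK C F.L rr β₀) (hμ : 0 < C.μ) (d n : ℕ)
    (hκ₁ : (d : ℝ) * Real.log F.L + 2 * Real.log 2 ≤ C.κ₁) (hE₀ : Real.log (2 + birthMass C) ≤ C.E₀)
    -- the flow side (⇐ BetaPertH, displayed) and tuning
    {γ₀ γb b β' : ℝ} {pe : ℕ} (hb : 0 ≤ b) (hlo : FlowStep.BetaLowerH b γ₀ D.βfun)
    (hhi : FlowStep.BetaUpperH β' γ₀ D.βfun) (hγ : γb ≤ γ₀) (hγβ : γb ^ 2 * β' < 1)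
    (S : B14FlowStep.SmallnessFor γb β' β₀ F.L pe) (hp₀ : C.p₀ ≤ pe) (hrr : rr ≤ pe)
    {g : ℝ} {g₀ : ℕ → ℝ} (ht : D.Tuned γb g g₀)
    (hir : irThresholdTLE C F.L rr β₀ ≤ Real.log (g ^ 2)⁻¹)
    -- the (B) side
    (hsign : B16.SignConventions D.C) {γB : ℝ} {em ep : ℝ → ℝ} (hcor : B16.Cor3With D.C γB em ep) (hγB : γb ≤ γB)
    {obs : (K : ℕ) → GaugeField (F.P K) 0 G → ℝ} {B : ℝ}
    (hobs : ∀ K, Measurable (obs K)) (hbd : ∀ K U, |obs K U| ≤ B)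
    (hα : ∀ K t, |t| ≤ l₀ → K₀ ≤ K →
      ∫ U, Real.exp (t * obs K U) * D.dens K (g₀ K) 0 U ∂fieldMeasure (F.P K) 0 G ≤ ∑ τ ∈ T K, A K t τ)
    (hα' : ∀ K t, |t| ≤ l₀ → K₀ ≤ K →
      ∫ U, Real.exp (t * obs (K + 1) U) * D.dens (K + 1) (g₀ (K + 1)) 0 U ∂fieldMeasure (F.P (K + 1)) 0 G ≤
        ∑ τ ∈ T K, A' K t τ)
    {c₀ n₁ : ℝ} (hc₀ : 0 < c₀) (hfloor : ∀ K, K₀ ≤ K → c₀ ≤ smallFieldMass D K (g₀ K))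
    (hfloor' : ∀ K, K₀ ≤ K → c₀ ≤ smallFieldMass D (K + 1) (g₀ (K + 1)))
    (hsites : ∀ K, K₀ ≤ K → ((D.C ⟨K, F.m, g₀ K⟩).numSites K : ℝ) ≤ n₁)
    (hsites' : ∀ K, K₀ ≤ K → ((D.C ⟨K + 1, F.m, g₀ (K + 1)⟩).numSites (K + 1) : ℝ) ≤ n₁)
    (hNup : 0 ≤ Nup) (hnup : ∀ K t, |t| ≤ l₀ → K₀ ≤ K → 0 ≤ nup K t ∧ nup K t ≤ Nup)
    (hmup : ∀ K t, |t| ≤ l₀ → K₀ ≤ K → 0 ≤ mup K t ∧ mup K t ≤ Nup)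
    -- the (2.5) side condition on the size function
    (R : ℕ → ℕ → ℕ) (hR : ∀ K s, s ≤ K → B14.IsRj F.L rr ((D.C ⟨K, F.m, g₀ K⟩).flow.g s) (R K s))
    -- the side conditions of the geometric lemmas (row S1b): torus side, drop control PER CUTOFF, window constant, sizes
    {sP : ℕ → ℕ → ℕ} (hL4 : 4 ≤ F.L) (hdrop : ∀ K, K₀ ≤ K → ∀ m, B16SProfile.DropCtl (sP K) m) (hn₁ : 13 ≤ C.n₁)
    (hR1 : ∀ K, K₀ ≤ K → ∀ t, 1 ≤ R K t)
    -- H3: the terms read as REALISED PENDING PEDIGREES of live components with root cells, profile per cutoff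
    (ped : ℕ → ι → Pedigree α π) (cellP : ℕ → ι → π → Pt dP × Finset (Pt dP)) (liveC : ℕ → ι → Finset α)
    (cellOf : ℕ → ι → α → (Fin d → ℕ))
    (H : RealisedReadingR F.L sP (cellN d n F.L) K₀ R T ped cellP liveC cellOf)
    {Fc Rf Fc' Rf' : ℕ → Finset (BSlot (Fin d → ℕ) PEv) → ℝ}
    (hprice : ∀ K t, |t| ≤ l₀ → K₀ ≤ K → ∀ τ ∈ badTerms (memOf ped liveC cellOf) jhalf T K,
      Fc K (bstrOf Prod.fst (memOf ped liveC cellOf) K τ) * Rf K (bstrOf Prod.fst (memOf ped liveC cellOf) K τ) ≤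
        ∏ q ∈ memOf ped liveC cellOf K τ,
          priceT Prod.fst C ((F.L : ℝ) ^ d) R (fun K => (D.C ⟨K, F.m, g₀ K⟩).flow.g) K q)
    (hprice' : ∀ K t, |t| ≤ l₀ → K₀ ≤ K → ∀ τ ∈ badTerms (memOf ped liveC cellOf) jhalf T K,
      Fc' K (bstrOf Prod.fst (memOf ped liveC cellOf) K τ) * Rf' K (bstrOf Prod.fst (memOf ped liveC cellOf) K τ) ≤
        ∏ q ∈ memOf ped liveC cellOf K τ,
          priceT Prod.fst C ((F.L : ℝ) ^ d) R (fun K => (D.C ⟨K, F.m, g₀ K⟩).flow.g) K q)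
    -- H3: the remaining `Regeneration` numerator readings, over the classes of the terms
    (up : ∀ K t, |t| ≤ l₀ → K₀ ≤ K → ∀ c ∈ badClasses Prod.fst (memOf ped liveC cellOf) jhalf T K,
      ∀ τ ∈ fibre (bstrOf Prod.fst (memOf ped liveC cellOf)) T K c, A K t τ ≤ dead K t τ * Fc K c * nup K t)
    (dead_nonneg : ∀ K t, |t| ≤ l₀ → K₀ ≤ K → ∀ c ∈ badClasses Prod.fst (memOf ped liveC cellOf) jhalf T K,
      ∀ τ ∈ fibre (bstrOf Prod.fst (memOf ped liveC cellOf)) T K c, 0 ≤ dead K t τ)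
    (resum : ∀ K t, |t| ≤ l₀ → K₀ ≤ K → ∀ c ∈ badClasses Prod.fst (memOf ped liveC cellOf) jhalf T K,
      ∑ τ ∈ fibre (bstrOf Prod.fst (memOf ped liveC cellOf)) T K c, dead K t τ ≤ Rf K c)
    (F_nonneg : ∀ K t, |t| ≤ l₀ → K₀ ≤ K → ∀ c ∈ badClasses Prod.fst (memOf ped liveC cellOf) jhalf T K, 0 ≤ Fc K c)
    (up' : ∀ K t, |t| ≤ l₀ → K₀ ≤ K → ∀ c ∈ badClasses Prod.fst (memOf ped liveC cellOf) jhalf T K,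
      ∀ τ ∈ fibre (bstrOf Prod.fst (memOf ped liveC cellOf)) T K c, A' K t τ ≤ dead' K t τ * Fc' K c * mup K t)
    (dead'_nonneg : ∀ K t, |t| ≤ l₀ → K₀ ≤ K → ∀ c ∈ badClasses Prod.fst (memOf ped liveC cellOf) jhalf T K,
      ∀ τ ∈ fibre (bstrOf Prod.fst (memOf ped liveC cellOf)) T K c, 0 ≤ dead' K t τ)
    (resum' : ∀ K t, |t| ≤ l₀ → K₀ ≤ K → ∀ c ∈ badClasses Prod.fst (memOf ped liveC cellOf) jhalf T K,
      ∑ τ ∈ fibre (bstrOf Prod.fst (memOf ped liveC cellOf)) T K c, dead' K t τ ≤ Rf' K c)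
    (F'_nonneg : ∀ K t, |t| ≤ l₀ → K₀ ≤ K → ∀ c ∈ badClasses Prod.fst (memOf ped liveC cellOf) jhalf T K,
      0 ≤ Fc' K c)
    -- the seam's other inputs
    (hSh : ShellWeightBound l₀ T A A' shA shB Wsh)
    (hTB : ReindexedBudget l₀ vol T (fun K t τ => A K t τ - shA K t τ) (fun K t τ => A' K t τ - shB K t τ)
      (badOfClass (bstrOf Prod.fst (memOf ped liveC cellOf)) T
        (fun K _ => badClasses Prod.fst (memOf ped liveC cellOf) jhalf T K)) Cc Rr CcRec RrRec ν u s₂ q₀ r s)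
    (hr : Summable r) (hu : Summable u) (hs : Summable s) (hs₂ : Summable s₂) :
    ∃ K₁ K₂, K₀ ≤ K₁ ∧ HybridNE7 l₀ vol (fun K => T (K₁ + (K₂ + K))) (fun K => A (K₁ + (K₂ + K)))
      (fun K => A' (K₁ + (K₂ + K)))
      (fun K => badOfClass (bstrOf Prod.fst (memOf ped liveC cellOf)) T
        (fun K _ => badClasses Prod.fst (memOf ped liveC cellOf) jhalf T K) (K₁ + (K₂ + K)))
      (fun K => constOf l₀ B (max (em g) 0) n₁ c₀ Nup *
        recordsBudget (birthMass C) C.κ₁ ((n : ℝ) ^ d) ((F.L : ℝ) ^ d) (Real.log 2) jhalf (K₁ + (K₂ + K)))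
      (fun K => shA (K₁ + (K₂ + K))) (fun K => shB (K₁ + (K₂ + K))) (fun K => Wsh (K₁ + (K₂ + K)))
      (fun K => (r (K₁ + (K₂ + K)) + u (K₁ + (K₂ + K))) + (s (K₁ + (K₂ + K)) + s₂ (K₁ + (K₂ + K)))) :=
  hybridNE7_of_termReadingLE_canon D Prod.fst h hμ d n (dcapOf Prod.fst T (memOf ped liveC cellOf))
    (ncapOf T (memOf ped liveC cellOf)) hκ₁ hE₀ hb hlo hhi hγ hγβ S hp₀ hrr ht hir hsign hcor hγB hobs hbd hα hα' hc₀
    hfloor hfloor' hsites hsites' hNup hnup hmup R hR (memOf ped liveC cellOf)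
    (termReadingLE_of_realisedR hL4 hdrop hn₁ hR1 H jhalf) hprice hprice' up dead_nonneg resum F_nonneg up'
    dead'_nonneg resum' F'_nonneg hSh hTB hr hu hs hs₂

end End

end

end Summit.QuantumFields.BalabanUV.T4Continuum.HistoryAssemblyRealiseRun
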